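import Summits.BirchSwinnertonDyer.BirchSwinnertonDyer.Theorems.ClassRecordThreeShimuraKolyvaginImageDisjoint
import HarnessLib

/-!
# `E(K)[p^M] = 0` for a quadratic `K` with `(d_K, p N_E)`-coprime witness, whenever `E[p]` carries
# an element of `Γ_ℚ` acting as `−1` (cell `bsd-stepL`, seat `bsd-stepL-shim3b` g4; helper for
# the record item stmt-BirchSwinnertonDyer-19616 `ShimuraKolyvaginOrderBoundAtThree`)

HONEST FRAMING (programme file §HONESTY, verbatim): «no tranche here proves BSD; ARM L moves the
LITERAL column of an r ≤ 1 census into the kernel-proved-modulo-named-print column; ARM P changes what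
«named print» is worth. The residue (4.31 %) and every SUMMIT-BEARING rung (S0–S3) stay theorem-bound
and are staffed by the 22 routes, not by this programme.» THEOREMS ONLY (no definition, no named fact,
no `sorry`); nothing here is a BSD class theorem; no census label moves; item 19616 stays ASIDE.

## What this file does

The fourth image input of the tree's Kolyvagin machine is the torsion leaf `E(K)[p^∞] = 0`
(`Gross1991_torsionBy_eq_bot`, Gross 1991 §2 after (2.2), there from `ρ̄_{E,p}` onto; seat g3's
`ShimuraKolyvaginImageOverK.torsionBy_three_pow_eq_bot_of_irr` at `p = 3` from `Irr` alone, through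
squares).  Here, for ANY odd `p`, in the shape of the companions
`ShimuraKolyvaginCebotarevOfImageOdd.*`: if some `γ ∈ Γ_ℚ` acts as `−1` on `E(ℚ̄)[p]` and `K` is a
quadratic field with a prime `q ∣ d_K`, `q ∤ p N_E` (Gross's disjointness, prequel
`ShimuraKolyvaginImageDisjoint`), then `E(K)[p^M] = 0` for every `M ≥ 1`:

* `torsionBy_pow_eq_bot_of_neg_type` (`K : Type`) and `torsionBy_pow_eq_bot_of_neg` (any universe,
  by universe descent through a primitive element as in seat g3's file).

Proof (seat g3's, with the square replaced by a restriction): a `K`-rational `p^M`-torsion point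
pulls back to `Q ∈ E(ℚ̄)[p^M]` fixed by `res(Γ_K)`; by disjointness `γ` acts on `E[p]` as `res g`
for some `g ∈ Γ_K` (`exists_absGaloisRestrict_smul_eq`), so `res(g^{p^{M−1}})` acts as `−1` on
`E[p^M]` (`smul_eq_neg_geomTorsion_pow`) and fixes `Q`: `Q = −Q`, `2Q = 0 = p^M Q`, `Q = 0`.

NOT claimed: images without `−1` over `ℚ`; any Kolyvagin class or bound.

References: [GrossLMS1991] §2 (after (2.2)), §9 (PDF p. 227); [SilvermanAEC2009] VIII.§1.
-/

set_option autoImplicit false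
set_option linter.dupNamespace false -- the Theorems namespace repeats the summit name, as in every sibling

noncomputable section

open scoped Classical

open Field WeierstrassCurve NumberField
  Literature.NumberTheory.EllipticCurves Literature.NumberTheory.GaloisRepresentations
  Summit.BirchSwinnertonDyer.BirchSwinnertonDyer.Theorems.ShimuraKolyvaginImageDisjoint

universe u

namespace Summit.BirchSwinnertonDyer.BirchSwinnertonDyer.Theorems.ShimuraKolyvaginTorsionOfNeg

variable (W : WeierstrassCurve ℚ) [W.IsElliptic]

/-- **`E(K)[p^M] = 0` for a quadratic number field `K` (in `Type`)** when some `γ ∈ Γ_ℚ` acts as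
`−1` on `E(ℚ̄)[p]` (`p` odd, `M ≥ 1`) and some prime `q ∣ d_K` has `q ∤ p N_E`.  Seat g3's argument
(`ShimuraKolyvaginImageOverK.torsionBy_three_pow_eq_bot_of_irr_type`) with the square of `Γ_ℚ`
replaced by the restriction `res g` acting as `γ` (`exists_absGaloisRestrict_smul_eq`).
[cite: GrossLMS1991, §2 (sentence after (2.2))] -/
theorem torsionBy_pow_eq_bot_of_neg_type (K : Type) [Field K] [NumberField K]
    (hK : Module.finrank ℚ K = 2) {q : ℕ} (hq : q.Prime) (hqd : (q : ℤ) ∣ NumberField.discr K)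
    (hqN : ¬ q ∣ W.conductorNorm ℤ) {p : ℕ} (hp : p.Prime) (hp2 : p ≠ 2)
    (hqp : ¬ (q : ℤ) ∣ (p : ℤ))
    (hneg : ∃ γ : absoluteGaloisGroup ℚ, ∀ P : geomTorsion W p, γ • P = -P) {M : ℕ} (hM : 1 ≤ M) :
    AddSubgroup.torsionBy (W.baseChange K).toAffine.Point ((p ^ M : ℕ) : ℤ) = ⊥ := by
  rw [eq_bot_iff]
  intro P hP
  rw [AddSubgroup.mem_bot]
  have hPp : ((p ^ M : ℕ) : ℤ) • P = 0 := (Submodule.mem_torsionBy_iff _ _).mp hP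
  -- the point over `K̄` and its preimage `Q` over `ℚ̄`
  let f : K →ₐ[ℚ] AlgebraicClosure K := (algebraMap K (AlgebraicClosure K)).toRatAlgHom
  let φ : (W.baseChange K).toAffine.Point →+ localPoints W K :=
    WeierstrassCurve.Affine.Point.map f
  have hφ : Function.Injective φ := WeierstrassCurve.Affine.Point.map_injective _
  obtain ⟨Q, hQ⟩ := (pointsMapOfEmb_bijective K W (closureEmb (K := ℚ) K)).2 (φ P)
  have hQ' : pointsMap W K Q = φ P := hQ
  have hinj : Function.Injective (pointsMap W K) :=
    (pointsMapOfEmb_bijective K W (closureEmb (K := ℚ) K)).1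
  have hQp : ((p ^ M : ℕ) : ℤ) • Q = 0 := by
    apply hinj
    rw [map_zsmul, map_zero, hQ', ← map_zsmul, hPp, map_zero]
  -- `Q` is fixed by `res(Γ_K)`
  have hfixK : ∀ τ : absoluteGaloisGroup K, resGal (K := ℚ) K τ • Q = Q := by
    intro τ
    apply hinj
    rw [pointsMap_smul, hQ']
    change WeierstrassCurve.Affine.Point.map
        ((AlgEquiv.restrictScalars ℚ (absoluteGaloisGroup.toAlgEquiv K τ) :
            AlgebraicClosure K ≃ₐ[ℚ] AlgebraicClosure K) :
          AlgebraicClosure K →ₐ[ℚ] AlgebraicClosure K)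
        (WeierstrassCurve.Affine.Point.map f P) =
      WeierstrassCurve.Affine.Point.map f P
    have hgf : ((AlgEquiv.restrictScalars ℚ (absoluteGaloisGroup.toAlgEquiv K τ) :
            AlgebraicClosure K ≃ₐ[ℚ] AlgebraicClosure K) :
          AlgebraicClosure K →ₐ[ℚ] AlgebraicClosure K).comp f = f := by
      ext x
      exact (absoluteGaloisGroup.toAlgEquiv K τ).commutes x
    rw [WeierstrassCurve.Affine.Point.map_map, hgf]
  -- an element of `res(Γ_K)` acting as `−1` on `E[p]`, hence `res(g^{p^{M-1}})` on `E[p^M]`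
  obtain ⟨γ, hγ⟩ := hneg
  obtain ⟨g, hg⟩ := exists_absGaloisRestrict_smul_eq W K hK hq hqd hqN hqp γ
  have hz : ∀ P : geomTorsion W p, resGal (K := ℚ) K g • P = -P := fun P ↦ by
    rw [resGal_eq_absGaloisRestrict, hg, hγ]
  have hodd : Odd p := hp.odd_of_ne_two hp2
  let Qm : geomTorsion W ((p ^ M : ℕ) : ℤ) := ⟨Q, (Submodule.mem_torsionBy_iff _ _).mpr hQp⟩
  have hneg' := smul_eq_neg_geomTorsion_pow W hodd hM hz Qm
  have hval : (resGal (K := ℚ) K g ^ p ^ (M - 1)) • Q = -Q := by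
    have := congrArg Subtype.val hneg'
    simpa only [AddSubgroup.torsionBy.coe_smul, NegMemClass.coe_neg] using this
  rw [← map_pow, hfixK] at hval
  -- `Q = −Q` and `p^M Q = 0` force `Q = 0`
  have hQ0 : Q = 0 := by
    have h2 : (2 : ℤ) • Q = 0 := by
      rw [two_zsmul]
      nth_rewrite 2 [hval]
      exact add_neg_cancel Q
    have hcop : IsCoprime (2 : ℤ) ((p ^ M : ℕ) : ℤ) := by
      rw [Nat.cast_pow, Int.isCoprime_iff_gcd_eq_one, Int.gcd_comm]
      have h := ((Nat.coprime_primes hp Nat.prime_two).mpr hp2).pow_left M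
      exact_mod_cast h
    obtain ⟨a, b, hab⟩ := hcop
    calc Q = (1 : ℤ) • Q := (one_zsmul Q).symm
      _ = (a * 2 + b * ((p ^ M : ℕ) : ℤ)) • Q := by rw [hab]
      _ = 0 := by rw [add_zsmul, mul_zsmul, mul_zsmul, h2, hQp, zsmul_zero, zsmul_zero, add_zero]
  apply hφ
  rw [map_zero, ← hQ', hQ0, map_zero]

/-- **`E(K)[p^M] = 0`, any universe**: `K` a quadratic number field with a prime `q ∣ d_K`,
`q ∤ p N_E`, `p` odd, some `γ ∈ Γ_ℚ` acting as `−1` on `E(ℚ̄)[p]`, `M ≥ 1` — universe descent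
through a primitive element (`exists_algEquiv_numberField_type`, `torsionBy_eq_bot_of_algEquiv`;
`[K:ℚ]` and `d_K` are isomorphism invariants). The image-free torsion leaf of the tree's Kolyvagin
machine (`Gross1991_torsionBy_eq_bot`, there from `ρ̄_{E,p}` onto).
[cite: GrossLMS1991, §2 (sentence after (2.2))] -/
theorem torsionBy_pow_eq_bot_of_neg (L : Type u) [Field L] [NumberField L]
    (hL : Module.finrank ℚ L = 2) {q : ℕ} (hq : q.Prime) (hqd : (q : ℤ) ∣ NumberField.discr L)
    (hqN : ¬ q ∣ W.conductorNorm ℤ) {p : ℕ} (hp : p.Prime) (hp2 : p ≠ 2)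
    (hqp : ¬ (q : ℤ) ∣ (p : ℤ))
    (hneg : ∃ γ : absoluteGaloisGroup ℚ, ∀ P : geomTorsion W p, γ • P = -P) {M : ℕ} (hM : 1 ≤ M) :
    AddSubgroup.torsionBy (W.baseChange L).toAffine.Point ((p ^ M : ℕ) : ℤ) = ⊥ := by
  obtain ⟨K₀, _, _, ⟨e⟩⟩ := exists_algEquiv_numberField_type L
  have hK₀ : Module.finrank ℚ K₀ = 2 := by rw [← hL]; exact e.toLinearEquiv.finrank_eq
  have hd₀ : (q : ℤ) ∣ NumberField.discr K₀ := by
    rwa [NumberField.discr_eq_discr_of_algEquiv K₀ e]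
  exact torsionBy_eq_bot_of_algEquiv W e (p := p ^ M)
    (torsionBy_pow_eq_bot_of_neg_type W K₀ hK₀ hq hd₀ hqN hp hp2 hqp hneg hM)

end Summit.BirchSwinnertonDyer.BirchSwinnertonDyer.Theorems.ShimuraKolyvaginTorsionOfNeg

end
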